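import Literature.NumberTheory.LFunctions.KloostermanFractionsFromBC71tau
import Literature.NumberTheory.LFunctions.KloostermanFractionsCoprimeReduction
import HarnessLib

/-!
# Bilinear forms with Kloosterman fractions: from Bettin–Chandee (6.4) to the named fact

Topic `NumberTheory/LFunctions`.  S. Bettin, V. Chandee, *Trilinear forms with Kloosterman
fractions*, Adv. Math. 328 (2018), §7: "Combining the bound (6.4) for `𝓒₁` and (2.1) [Cauchy–Schwarz
in `m`], we deduce (7.1) … If `M ≥ N` this implies [Theorem 1 in the range `M ≥ N`]".  This file
PROVES that step for a single numerator (`A = 1`, `ϑ = k`) and chains it with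
`KloostermanFractionsFromBC71tau.lean`, so that the named fact
`DukeFriedlanderIwaniec1997_bilinearKloostermanFractions` follows from a bound of the shape (6.4)
for the second moment WITH `m ∼ M`,
`𝓒₁ = ∑_{⌊M⌋ < m ≤ ⌊2M⌋} |∑_{n ≤ 2N,(m,n)=1} β_n e(k m̄/n)|²`, `β` supported on `N < n ≤ 2N`
coprime to `k`, all `M, N ≥ 1/2` ((6.4) "holds also without the assumption `ϑ, A, N ≪ M^C`", §6):

* `DFI_bilinear_le_norm_mul_sqrt_C_Ioc` — `|𝓑| ≤ ‖α‖ 𝓒₁^{1/2}` keeping only `m` in the support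
  `(M, 2M]` of `α` ((2.1) = (bfc) of the source);
* `DFI_sqrt_S4_le`, `DFI_S_le_of_le` — `√(MN^{3/4} + N^{7/4} + M^{6/5}N^{7/10} + M^{3/5}N^{13/10}) ≤ M^{1/2}N^{3/8} + N^{7/8} + M^{3/5}N^{7/20} + M^{3/10}N^{13/20} ≤ 2(M^{1/2}N^{3/8} + M^{3/5}N^{7/20})` for `N ≤ M`;
* `DFI_bilinear_coprime_of_C1_bound` — (7.1) for `β` coprime to `k`;
* **`DFI_BC71tau_of_C1_bound`** — the general case through the tree's `DFI_bilinear_bound_of_coprime_case`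
  (with the clamped, `N`-monotone bound `G(M,N,k) = K(1+|k|)^ε(M⁺N*)^ε(1+|k|/(M⁺N*))^{1/4}S(M⁺,N*)`,
  `N* = max(N, 1/2)`), giving the hypothesis of `…_of_BC71tau_MgeN`;
* **`DukeFriedlanderIwaniec1997_bilinearKloostermanFractions_of_C1_bound`** — the named fact from
  the (6.4)-shape hypothesis (written out; the factor `(1+|k|)^ε` accommodates the logarithms of the
  numerator in the amplification, `L > 2 log(bϑM)`).

## References

* S. Bettin, V. Chandee, Adv. Math. 328 (2018) 1234–1262 (arXiv:1502.00769), §§2, 6, 7.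
  [BettinChandee2018]
* W. Duke, J. Friedlander, H. Iwaniec, Invent. Math. 128 (1997) 23–43, Theorem 2.
  [DukeFriedlanderIwaniec1997]
-/

noncomputable section

open Finset Real Complex

namespace Literature.NumberTheory.LFunctions

/-- `√(M N^{3/4} + N^{7/4} + M^{6/5}N^{7/10} + M^{3/5}N^{13/10}) ≤ M^{1/2}N^{3/8} + N^{7/8} + M^{3/5}N^{7/20} + M^{3/10}N^{13/20}`
(the passage from (6.4) to (7.1) of Bettin–Chandee: `√(∑ tᵢ²) ≤ ∑ tᵢ`). [cite: BettinChandee2018, §7] -/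
theorem DFI_sqrt_S4_le {M N : ℝ} (hM : 0 < M) (hN : 0 < N) :
    Real.sqrt (M * N ^ (3 / 4 : ℝ) + N ^ (7 / 4 : ℝ) + M ^ (6 / 5 : ℝ) * N ^ (7 / 10 : ℝ) +
        M ^ (3 / 5 : ℝ) * N ^ (13 / 10 : ℝ)) ≤
      M ^ (1 / 2 : ℝ) * N ^ (3 / 8 : ℝ) + N ^ (7 / 8 : ℝ) + M ^ (3 / 5 : ℝ) * N ^ (7 / 20 : ℝ) +
        M ^ (3 / 10 : ℝ) * N ^ (13 / 20 : ℝ) := by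
  obtain ⟨a, ha⟩ : ∃ a : ℝ, a = Real.log M := ⟨_, rfl⟩
  obtain ⟨b, hb⟩ : ∃ b : ℝ, b = Real.log N := ⟨_, rfl⟩
  have eM : ∀ c : ℝ, M ^ c = Real.exp (c * a) := fun c => by
    rw [Real.rpow_def_of_pos hM, mul_comm, ha]
  have eN : ∀ c : ℝ, N ^ c = Real.exp (c * b) := fun c => by
    rw [Real.rpow_def_of_pos hN, mul_comm, hb]
  have eM1 : M = Real.exp a := by rw [ha, Real.exp_log hM]
  set t₁ := Real.exp (1 / 2 * a + 3 / 8 * b) with ht₁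
  set t₂ := Real.exp (7 / 8 * b) with ht₂
  set t₃ := Real.exp (3 / 5 * a + 7 / 20 * b) with ht₃
  set t₄ := Real.exp (3 / 10 * a + 13 / 20 * b) with ht₄
  have h₁ : M ^ (1 / 2 : ℝ) * N ^ (3 / 8 : ℝ) = t₁ := by rw [eM, eN, ← Real.exp_add]
  have h₂ : N ^ (7 / 8 : ℝ) = t₂ := by rw [eN]
  have h₃ : M ^ (3 / 5 : ℝ) * N ^ (7 / 20 : ℝ) = t₃ := by rw [eM, eN, ← Real.exp_add]
  have h₄ : M ^ (3 / 10 : ℝ) * N ^ (13 / 20 : ℝ) = t₄ := by rw [eM, eN, ← Real.exp_add]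
  have u₁ : M * N ^ (3 / 4 : ℝ) = t₁ ^ 2 := by
    rw [eM1, eN, ← Real.exp_add, ht₁, sq, ← Real.exp_add]; ring_nf
  have u₂ : N ^ (7 / 4 : ℝ) = t₂ ^ 2 := by
    rw [eN, ht₂, sq, ← Real.exp_add]; ring_nf
  have u₃ : M ^ (6 / 5 : ℝ) * N ^ (7 / 10 : ℝ) = t₃ ^ 2 := by
    rw [eM, eN, ← Real.exp_add, ht₃, sq, ← Real.exp_add]; ring_nf
  have u₄ : M ^ (3 / 5 : ℝ) * N ^ (13 / 10 : ℝ) = t₄ ^ 2 := by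
    rw [eM, eN, ← Real.exp_add, ht₄, sq, ← Real.exp_add]; ring_nf
  rw [h₁, h₂, h₃, h₄, u₁, u₂, u₃, u₄]
  have p₁ : 0 < t₁ := Real.exp_pos _
  have p₂ : 0 < t₂ := Real.exp_pos _
  have p₃ : 0 < t₃ := Real.exp_pos _
  have p₄ : 0 < t₄ := Real.exp_pos _
  have hS0 : 0 ≤ t₁ + t₂ + t₃ + t₄ := by positivity
  have hle : t₁ ^ 2 + t₂ ^ 2 + t₃ ^ 2 + t₄ ^ 2 ≤ (t₁ + t₂ + t₃ + t₄) ^ 2 := by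
    nlinarith [mul_pos p₁ p₂, mul_pos p₁ p₃, mul_pos p₁ p₄, mul_pos p₂ p₃, mul_pos p₂ p₄, mul_pos p₃ p₄]
  calc Real.sqrt (t₁ ^ 2 + t₂ ^ 2 + t₃ ^ 2 + t₄ ^ 2) ≤ Real.sqrt ((t₁ + t₂ + t₃ + t₄) ^ 2) :=
        Real.sqrt_le_sqrt hle
    _ = t₁ + t₂ + t₃ + t₄ := Real.sqrt_sq hS0

/-- For `0 < N ≤ M`: `M^{1/2}N^{3/8} + N^{7/8} + M^{3/5}N^{7/20} + M^{3/10}N^{13/20} ≤ 2(M^{1/2}N^{3/8} + M^{3/5}N^{7/20})`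
("If `M ≥ N` this implies …", Bettin–Chandee §7). [cite: BettinChandee2018, §7] -/
theorem DFI_S_le_of_le {M N : ℝ} (hN : 0 < N) (hNM : N ≤ M) :
    M ^ (1 / 2 : ℝ) * N ^ (3 / 8 : ℝ) + N ^ (7 / 8 : ℝ) + M ^ (3 / 5 : ℝ) * N ^ (7 / 20 : ℝ) +
        M ^ (3 / 10 : ℝ) * N ^ (13 / 20 : ℝ) ≤
      2 * (M ^ (1 / 2 : ℝ) * N ^ (3 / 8 : ℝ) + M ^ (3 / 5 : ℝ) * N ^ (7 / 20 : ℝ)) := by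
  have hM : 0 < M := by linarith
  obtain ⟨a, ha⟩ : ∃ a : ℝ, a = Real.log M := ⟨_, rfl⟩
  obtain ⟨b, hb⟩ : ∃ b : ℝ, b = Real.log N := ⟨_, rfl⟩
  have hba : b ≤ a := by rw [ha, hb]; exact Real.log_le_log hN hNM
  have eM : ∀ c : ℝ, M ^ c = Real.exp (c * a) := fun c => by
    rw [Real.rpow_def_of_pos hM, mul_comm, ha]
  have eN : ∀ c : ℝ, N ^ c = Real.exp (c * b) := fun c => by
    rw [Real.rpow_def_of_pos hN, mul_comm, hb]
  have h2 : N ^ (7 / 8 : ℝ) ≤ M ^ (1 / 2 : ℝ) * N ^ (3 / 8 : ℝ) := by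
    rw [eN, eM, eN, ← Real.exp_add]
    exact Real.exp_le_exp.mpr (by linarith)
  have h4 : M ^ (3 / 10 : ℝ) * N ^ (13 / 20 : ℝ) ≤ M ^ (3 / 5 : ℝ) * N ^ (7 / 20 : ℝ) := by
    rw [eM, eN, eM, eN, ← Real.exp_add, ← Real.exp_add]
    exact Real.exp_le_exp.mpr (by linarith)
  linarith

/-- **`𝓑 ≤ ‖α‖ 𝓒₁^{1/2}` with the `m`-sum restricted to the support `M < m ≤ 2M` of `α`**
(Cauchy–Schwarz in `m`, as `DFI_bilinear_le_norm_mul_sqrt_C` of the tree, but keeping only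
`m ∈ (⌊M⌋, ⌊2M⌋]`, where `α` lives): this is the second moment `𝓒₁` with `m ∼ M` of
Bettin–Chandee §2 (bfc). [cite: BettinChandee2018, §2 (bfc)] -/
theorem DFI_bilinear_le_norm_mul_sqrt_C_Ioc (M N : ℝ) (k : ℤ) (α β : ℕ → ℂ)
    (hα : ∀ m : ℕ, α m ≠ 0 → M < m ∧ (m : ℝ) ≤ 2 * M) :
    ‖∑ m ∈ Icc 1 ⌊2 * M⌋₊, ∑ n ∈ Icc 1 ⌊2 * N⌋₊,
        if m.Coprime n then
          α m * β n * Complex.exp (2 * Real.pi * Complex.I *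
            ((k : ℂ) * ((((m : ZMod n)⁻¹).val : ℕ) : ℂ) / (n : ℂ)))
        else 0‖ ≤
      Real.sqrt (∑ m ∈ Icc 1 ⌊2 * M⌋₊, ‖α m‖ ^ 2) *
        Real.sqrt (∑ m ∈ Ioc ⌊M⌋₊ ⌊2 * M⌋₊, ‖∑ n ∈ Icc 1 ⌊2 * N⌋₊,
          if m.Coprime n then
            β n * Complex.exp (2 * Real.pi * Complex.I *
              ((k : ℂ) * ((((m : ZMod n)⁻¹).val : ℕ) : ℂ) / (n : ℂ)))
          else 0‖ ^ 2) := by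
  set S : ℕ → ℂ := fun m => ∑ n ∈ Icc 1 ⌊2 * N⌋₊,
    if m.Coprime n then
      β n * Complex.exp (2 * Real.pi * Complex.I *
        ((k : ℂ) * ((((m : ZMod n)⁻¹).val : ℕ) : ℂ) / (n : ℂ)))
    else 0 with hS
  have hfac : ∀ m : ℕ, (∑ n ∈ Icc 1 ⌊2 * N⌋₊,
        if m.Coprime n then
          α m * β n * Complex.exp (2 * Real.pi * Complex.I *
            ((k : ℂ) * ((((m : ZMod n)⁻¹).val : ℕ) : ℂ) / (n : ℂ)))
        else 0) = α m * S m := by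
    intro m
    rw [hS, Finset.mul_sum]
    refine Finset.sum_congr rfl fun n _ => ?_
    split_ifs
    · ring
    · rw [mul_zero]
  simp_rw [hfac]
  -- the terms with `m ≤ ⌊M⌋` vanish
  have hsub : Ioc ⌊M⌋₊ ⌊2 * M⌋₊ ⊆ Icc 1 ⌊2 * M⌋₊ := by
    intro m hm
    rw [Finset.mem_Ioc] at hm
    rw [Finset.mem_Icc]
    exact ⟨by omega, hm.2⟩
  have hvanish : ∀ m ∈ Icc 1 ⌊2 * M⌋₊, m ∉ Ioc ⌊M⌋₊ ⌊2 * M⌋₊ → α m * S m = 0 := by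
    intro m hm hm'
    rw [Finset.mem_Icc] at hm
    rw [Finset.mem_Ioc, not_and_or] at hm'
    have hmM : m ≤ ⌊M⌋₊ := by omega
    have hα0 : α m = 0 := by
      by_contra h
      have h1 := (hα m h).1
      have h2 : (m : ℝ) ≤ ⌊M⌋₊ := by exact_mod_cast hmM
      have hM0 : 0 ≤ M := by
        by_contra hneg
        push Not at hneg
        have : (m : ℝ) < 0 := by linarith [(hα m h).2]
        linarith [Nat.cast_nonneg (α := ℝ) m]
      linarith [Nat.floor_le hM0]
    rw [hα0, zero_mul]
  rw [← Finset.sum_subset hsub hvanish]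
  calc ‖∑ m ∈ Ioc ⌊M⌋₊ ⌊2 * M⌋₊, α m * S m‖
      ≤ Real.sqrt (∑ m ∈ Ioc ⌊M⌋₊ ⌊2 * M⌋₊, ‖α m‖ ^ 2) *
          Real.sqrt (∑ m ∈ Ioc ⌊M⌋₊ ⌊2 * M⌋₊, ‖S m‖ ^ 2) := DFI_norm_sum_mul_le_sqrt_mul_sqrt _ _ _
    _ ≤ Real.sqrt (∑ m ∈ Icc 1 ⌊2 * M⌋₊, ‖α m‖ ^ 2) *
          Real.sqrt (∑ m ∈ Ioc ⌊M⌋₊ ⌊2 * M⌋₊, ‖S m‖ ^ 2) := by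
        have hle : ∑ m ∈ Ioc ⌊M⌋₊ ⌊2 * M⌋₊, ‖α m‖ ^ 2 ≤ ∑ m ∈ Icc 1 ⌊2 * M⌋₊, ‖α m‖ ^ 2 :=
          Finset.sum_le_sum_of_subset_of_nonneg hsub fun _ _ _ => sq_nonneg _
        gcongr

/-- **From (6.4) to (7.1), coefficients coprime to `k`.**  Suppose (Bettin–Chandee (6.4), case
`A = 1`, untwisted, in the tree's conventions) that for every `ε > 0` there is `K` with, for all
`M, N ≥ 1/2`, `k ≠ 0` and `β` supported on `N < n ≤ 2N`, `(n,k) = 1`,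
`𝓒₁ = ∑_{M < m ≤ 2M}|∑_{n ≤ 2N,(m,n)=1} β_n e(k m̄/n)|² ≤ K (1+|k|)^ε ‖β‖² (MN)^ε (1 + |k|/MN)^{1/2}(MN^{3/4} + N^{7/4} + M^{6/5}N^{7/10} + M^{3/5}N^{13/10})`.
Then (Cauchy–Schwarz in `m`, `DFI_bilinear_le_norm_mul_sqrt_C_Ioc`) for the same `M, N, k` and all `α` supported on `(M, 2M]`,
`|∑∑_{(m,n)=1} α_m β_n e(k m̄/n)| ≤ K^{1/2} ‖α‖‖β‖ (MN)^{ε/2} (1 + |k|/MN)^{1/4}(M^{1/2}N^{3/8} + N^{7/8} + M^{3/5}N^{7/20} + M^{3/10}N^{13/20})`.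
[cite: BettinChandee2018, §7 (7.1)] -/
theorem DFI_bilinear_coprime_of_C1_bound {K ε M N : ℝ} (hK : 0 < K) (hM : 1 / 2 ≤ M)
    (hN : 1 / 2 ≤ N) {k : ℤ} {α β : ℕ → ℂ} (hα : ∀ m : ℕ, α m ≠ 0 → M < m ∧ (m : ℝ) ≤ 2 * M)
    (hC : ∑ m ∈ Ioc ⌊M⌋₊ ⌊2 * M⌋₊, ‖∑ n ∈ Icc 1 ⌊2 * N⌋₊,
        (if m.Coprime n then
          β n * Complex.exp (2 * Real.pi * Complex.I *
            ((k : ℂ) * ((((m : ZMod n)⁻¹).val : ℕ) : ℂ) / (n : ℂ)))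
        else 0)‖ ^ 2 ≤
      K * (1 + |(k : ℝ)|) ^ ε * (∑ n ∈ Icc 1 ⌊2 * N⌋₊, ‖β n‖ ^ 2) * (M * N) ^ ε *
        (1 + |(k : ℝ)| / (M * N)) ^ (1 / 2 : ℝ) *
        (M * N ^ (3 / 4 : ℝ) + N ^ (7 / 4 : ℝ) + M ^ (6 / 5 : ℝ) * N ^ (7 / 10 : ℝ) +
          M ^ (3 / 5 : ℝ) * N ^ (13 / 10 : ℝ))) :
    ‖∑ m ∈ Icc 1 ⌊2 * M⌋₊, ∑ n ∈ Icc 1 ⌊2 * N⌋₊,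
        if m.Coprime n then
          α m * β n * Complex.exp (2 * Real.pi * Complex.I *
            ((k : ℂ) * ((((m : ZMod n)⁻¹).val : ℕ) : ℂ) / (n : ℂ)))
        else 0‖ ≤
      Real.sqrt (∑ m ∈ Icc 1 ⌊2 * M⌋₊, ‖α m‖ ^ 2) *
        Real.sqrt (∑ n ∈ Icc 1 ⌊2 * N⌋₊, ‖β n‖ ^ 2) *
        (Real.sqrt K * (1 + |(k : ℝ)|) ^ (ε / 2) * (M * N) ^ (ε / 2) *
          (1 + |(k : ℝ)| / (M * N)) ^ (1 / 4 : ℝ) *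
          (M ^ (1 / 2 : ℝ) * N ^ (3 / 8 : ℝ) + N ^ (7 / 8 : ℝ) + M ^ (3 / 5 : ℝ) * N ^ (7 / 20 : ℝ) +
            M ^ (3 / 10 : ℝ) * N ^ (13 / 20 : ℝ))) := by
  have hM0 : 0 < M := by linarith
  have hN0 : 0 < N := by linarith
  have hQ0 : 0 < M * N := mul_pos hM0 hN0
  have hk0 : 0 ≤ 1 + |(k : ℝ)| := by positivity
  have h1 := DFI_bilinear_le_norm_mul_sqrt_C_Ioc M N k α β hα
  refine h1.trans ?_
  rw [mul_assoc (Real.sqrt (∑ m ∈ Icc 1 ⌊2 * M⌋₊, ‖α m‖ ^ 2))]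
  refine mul_le_mul_of_nonneg_left ?_ (Real.sqrt_nonneg _)
  refine (Real.sqrt_le_sqrt hC).trans ?_
  set nβ2 : ℝ := ∑ n ∈ Icc 1 ⌊2 * N⌋₊, ‖β n‖ ^ 2 with hnβ2
  have hnβ0 : 0 ≤ nβ2 := Finset.sum_nonneg fun _ _ => sq_nonneg _
  have hW0 : 0 ≤ 1 + |(k : ℝ)| / (M * N) := by positivity
  rw [Real.sqrt_mul' _ (by positivity), Real.sqrt_mul' _ (by positivity), Real.sqrt_mul' _ (by positivity),
    Real.sqrt_mul' _ hnβ0, Real.sqrt_mul hK.le]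
  have e0 : Real.sqrt ((1 + |(k : ℝ)|) ^ ε) = (1 + |(k : ℝ)|) ^ (ε / 2) := by
    rw [Real.sqrt_eq_rpow, ← Real.rpow_mul hk0]; ring_nf
  have e1 : Real.sqrt ((M * N) ^ ε) = (M * N) ^ (ε / 2) := by
    rw [Real.sqrt_eq_rpow, ← Real.rpow_mul hQ0.le]; ring_nf
  have e2 : Real.sqrt ((1 + |(k : ℝ)| / (M * N)) ^ (1 / 2 : ℝ)) = (1 + |(k : ℝ)| / (M * N)) ^ (1 / 4 : ℝ) := by
    rw [Real.sqrt_eq_rpow, ← Real.rpow_mul hW0]; norm_num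
  rw [e0, e1, e2]
  have h3 := DFI_sqrt_S4_le hM0 hN0
  calc Real.sqrt K * (1 + |(k : ℝ)|) ^ (ε / 2) * Real.sqrt nβ2 * (M * N) ^ (ε / 2) *
        (1 + |(k : ℝ)| / (M * N)) ^ (1 / 4 : ℝ) *
        Real.sqrt (M * N ^ (3 / 4 : ℝ) + N ^ (7 / 4 : ℝ) + M ^ (6 / 5 : ℝ) * N ^ (7 / 10 : ℝ) +
          M ^ (3 / 5 : ℝ) * N ^ (13 / 10 : ℝ))
      ≤ Real.sqrt K * (1 + |(k : ℝ)|) ^ (ε / 2) * Real.sqrt nβ2 * (M * N) ^ (ε / 2) *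
        (1 + |(k : ℝ)| / (M * N)) ^ (1 / 4 : ℝ) *
        (M ^ (1 / 2 : ℝ) * N ^ (3 / 8 : ℝ) + N ^ (7 / 8 : ℝ) + M ^ (3 / 5 : ℝ) * N ^ (7 / 20 : ℝ) +
            M ^ (3 / 10 : ℝ) * N ^ (13 / 20 : ℝ)) := by gcongr
    _ = _ := by ring

/-- **From (6.4) to the hypothesis of `…_of_BC71tau_MgeN`** (Cauchy–Schwarz in `m`, the reduction
to `β` coprime to `k` of the tree — `DFI_bilinear_bound_of_coprime_case`, at the cost
`τ(|k|)^{1/2}` — and `N ≤ M`). [cite: BettinChandee2018, §§2, 7] -/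
theorem DFI_BC71tau_of_C1_bound
    (hC : ∀ ε : ℝ, 0 < ε → ∃ K : ℝ, 0 < K ∧
      ∀ (M N : ℝ), 1 / 2 ≤ M → 1 / 2 ≤ N → ∀ (k : ℤ), k ≠ 0 → ∀ (β : ℕ → ℂ),
        (∀ n : ℕ, β n ≠ 0 → N < n ∧ (n : ℝ) ≤ 2 * N) →
        (∀ n : ℕ, β n ≠ 0 → n.Coprime k.natAbs) →
        ∑ m ∈ Ioc ⌊M⌋₊ ⌊2 * M⌋₊, ‖∑ n ∈ Icc 1 ⌊2 * N⌋₊,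
            (if m.Coprime n then
              β n * Complex.exp (2 * Real.pi * Complex.I *
                ((k : ℂ) * ((((m : ZMod n)⁻¹).val : ℕ) : ℂ) / (n : ℂ)))
            else 0)‖ ^ 2 ≤
          K * (1 + |(k : ℝ)|) ^ ε * (∑ n ∈ Icc 1 ⌊2 * N⌋₊, ‖β n‖ ^ 2) * (M * N) ^ ε *
            (1 + |(k : ℝ)| / (M * N)) ^ (1 / 2 : ℝ) *
            (M * N ^ (3 / 4 : ℝ) + N ^ (7 / 4 : ℝ) + M ^ (6 / 5 : ℝ) * N ^ (7 / 10 : ℝ) +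
              M ^ (3 / 5 : ℝ) * N ^ (13 / 10 : ℝ))) :
    ∀ ε : ℝ, 0 < ε → ∃ K : ℝ, 0 < K ∧
      ∀ (M N : ℝ), 1 / 2 ≤ N → N ≤ M → ∀ (k : ℤ), k ≠ 0 → ∀ (α β : ℕ → ℂ),
        (∀ m : ℕ, α m ≠ 0 → M < m ∧ (m : ℝ) ≤ 2 * M) →
        (∀ n : ℕ, β n ≠ 0 → N < n ∧ (n : ℝ) ≤ 2 * N) →
        ‖∑ m ∈ Icc 1 ⌊2 * M⌋₊, ∑ n ∈ Icc 1 ⌊2 * N⌋₊,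
            if m.Coprime n then
              α m * β n * Complex.exp (2 * Real.pi * Complex.I *
                ((k : ℂ) * ((((m : ZMod n)⁻¹).val : ℕ) : ℂ) / (n : ℂ)))
            else 0‖ ≤
          K * Real.sqrt (k.natAbs.divisors.card : ℝ) * (1 + |(k : ℝ)|) ^ ε *
            Real.sqrt (∑ m ∈ Icc 1 ⌊2 * M⌋₊, ‖α m‖ ^ 2) *
            Real.sqrt (∑ n ∈ Icc 1 ⌊2 * N⌋₊, ‖β n‖ ^ 2) * (M * N) ^ ε *
            (1 + |(k : ℝ)| / (M * N)) ^ (1 / 4 : ℝ) *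
            (M ^ (1 / 2 : ℝ) * N ^ (3 / 8 : ℝ) + M ^ (3 / 5 : ℝ) * N ^ (7 / 20 : ℝ)) := by
  intro ε hε
  obtain ⟨K, hK, hCK⟩ := hC (2 * ε) (by positivity)
  refine ⟨2 * Real.sqrt K, by positivity, ?_⟩
  -- the bound function of the coprime case, clamped to be monotone in `N` on all of `ℝ`
  set S : ℝ → ℝ → ℝ := fun M' N' =>
    M' ^ (1 / 2 : ℝ) * N' ^ (3 / 8 : ℝ) + N' ^ (7 / 8 : ℝ) + M' ^ (3 / 5 : ℝ) * N' ^ (7 / 20 : ℝ) +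
      M' ^ (3 / 10 : ℝ) * N' ^ (13 / 20 : ℝ) with hS
  set G : ℝ → ℝ → ℤ → ℝ := fun M' N' k' =>
    Real.sqrt K * (1 + |(k' : ℝ)|) ^ (2 * ε / 2) * (max M' (1 / 2) * max N' (1 / 2)) ^ (2 * ε / 2) *
      (1 + |(k' : ℝ)| / (max M' (1 / 2) * max N' (1 / 2))) ^ (1 / 4 : ℝ) *
      S (max M' (1 / 2)) (max N' (1 / 2)) with hG
  have hmaxpos : ∀ x : ℝ, 0 < max x (1 / 2) := fun x => lt_max_of_lt_right (by norm_num)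
  have hSmono : ∀ M' : ℝ, 0 < M' → ∀ N₁ N₂ : ℝ, 0 < N₁ → N₁ ≤ N₂ → S M' N₁ ≤ S M' N₂ := by
    intro M' hM' N₁ N₂ hN₁ h12
    simp only [hS]
    gcongr
  have hS0 : ∀ M' N' : ℝ, 0 < M' → 0 < N' → 0 ≤ S M' N' := by
    intro M' N' hM' hN'; simp only [hS]; positivity
  have hG0 : ∀ M' N' k', 0 ≤ G M' N' k' := by
    intro M' N' k'
    simp only [hG]
    have := hmaxpos M'; have := hmaxpos N'
    have := hS0 (max M' (1 / 2)) (max N' (1 / 2)) (hmaxpos M') (hmaxpos N')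
    positivity
  have hGmono : ∀ (M' N' : ℝ) (k' : ℤ) (d : ℕ), 0 < d → (d : ℤ) ∣ k' →
      G M' (N' / d) (k' / d) ≤ G M' N' k' := by
    intro M' N' k' d hd hdk
    have hd1 : (1 : ℝ) ≤ d := by exact_mod_cast hd
    have hd0 : (0 : ℝ) < d := by linarith
    set M₀ := max M' (1 / 2) with hM₀
    set N₁ := max (N' / d) (1 / 2) with hN₁
    set N₂ := max N' (1 / 2) with hN₂
    have hM₀0 : 0 < M₀ := hmaxpos M'
    have hN₁0 : 0 < N₁ := hmaxpos _
    have hN₂0 : 0 < N₂ := hmaxpos _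
    have h12 : N₁ ≤ N₂ := by
      rcases le_or_gt 0 N' with h | h
      · exact max_le_max (div_le_self h hd1) le_rfl
      · have : N' / d < 1 / 2 := by
          have : N' / d ≤ 0 := div_nonpos_of_nonpos_of_nonneg h.le (by positivity)
          linarith
        rw [hN₁, max_eq_right this.le]
        exact le_max_right _ _
    -- `N₂ ≤ d N₁`
    have h21 : N₂ ≤ d * N₁ := by
      refine max_le ?_ ?_
      · have : N' / d ≤ N₁ := le_max_left _ _
        calc N' = d * (N' / d) := by field_simp
          _ ≤ d * N₁ := by gcongr
      · have : (1 / 2 : ℝ) ≤ N₁ := le_max_right _ _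
        nlinarith
    -- the numerator: `|k'/d| = |k'|/d`
    have hkd : |((k' / d : ℤ) : ℝ)| = |(k' : ℝ)| / d := by
      rw [Int.cast_div hdk (by exact_mod_cast hd.ne'), abs_div, Int.cast_natCast,
        abs_of_pos hd0]
    have hfrac : |((k' / d : ℤ) : ℝ)| / (M₀ * N₁) ≤ |(k' : ℝ)| / (M₀ * N₂) := by
      rw [hkd, div_div, div_le_div_iff₀ (by positivity) (by positivity)]
      have hk0 : 0 ≤ |(k' : ℝ)| := abs_nonneg _
      calc |(k' : ℝ)| * (M₀ * N₂) ≤ |(k' : ℝ)| * (M₀ * (d * N₁)) := by gcongr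
        _ = |(k' : ℝ)| * (d * (M₀ * N₁)) := by ring
    have hkabs : |((k' / d : ℤ) : ℝ)| ≤ |(k' : ℝ)| := by
      rw [hkd]
      exact div_le_self (abs_nonneg _) hd1
    simp only [hG]
    rw [← hM₀, ← hN₁, ← hN₂]
    have hε0 : 0 ≤ 2 * ε / 2 := by positivity
    have hA : (1 + |((k' / d : ℤ) : ℝ)|) ^ (2 * ε / 2) ≤ (1 + |(k' : ℝ)|) ^ (2 * ε / 2) :=
      Real.rpow_le_rpow (by positivity) (by linarith) hε0
    have hB : (M₀ * N₁) ^ (2 * ε / 2) ≤ (M₀ * N₂) ^ (2 * ε / 2) :=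
      Real.rpow_le_rpow (by positivity) (mul_le_mul_of_nonneg_left h12 hM₀0.le) hε0
    have hC : (1 + |((k' / d : ℤ) : ℝ)| / (M₀ * N₁)) ^ (1 / 4 : ℝ) ≤
        (1 + |(k' : ℝ)| / (M₀ * N₂)) ^ (1 / 4 : ℝ) :=
      Real.rpow_le_rpow (by positivity) (by linarith) (by norm_num)
    have hD : S M₀ N₁ ≤ S M₀ N₂ := hSmono M₀ hM₀0 N₁ N₂ hN₁0 h12
    have hS1 : 0 ≤ S M₀ N₁ := hS0 _ _ hM₀0 hN₁0
    have hS2 : 0 ≤ S M₀ N₂ := hS0 _ _ hM₀0 hN₂0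
    refine mul_le_mul (mul_le_mul (mul_le_mul (mul_le_mul_of_nonneg_left hA (Real.sqrt_nonneg _))
      hB (by positivity) (by positivity)) hC (by positivity) (by positivity)) hD hS1 (by positivity)
  have hcore : ∀ (M' N' : ℝ), 1 / 2 ≤ M' → 1 / 2 ≤ N' → ∀ (k' : ℤ), k' ≠ 0 → ∀ (α' β' : ℕ → ℂ),
      (∀ m : ℕ, α' m ≠ 0 → M' < m ∧ (m : ℝ) ≤ 2 * M') →
      (∀ n : ℕ, β' n ≠ 0 → N' < n ∧ (n : ℝ) ≤ 2 * N') →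
      (∀ n : ℕ, β' n ≠ 0 → n.Coprime k'.natAbs) →
      ‖∑ m ∈ Icc 1 ⌊2 * M'⌋₊, ∑ n ∈ Icc 1 ⌊2 * N'⌋₊,
          if m.Coprime n then
            α' m * β' n * Complex.exp (2 * Real.pi * Complex.I *
              ((k' : ℂ) * ((((m : ZMod n)⁻¹).val : ℕ) : ℂ) / (n : ℂ)))
          else 0‖ ≤
        Real.sqrt (∑ m ∈ Icc 1 ⌊2 * M'⌋₊, ‖α' m‖ ^ 2) *
          Real.sqrt (∑ n ∈ Icc 1 ⌊2 * N'⌋₊, ‖β' n‖ ^ 2) * G M' N' k' := by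
    intro M' N' hM' hN' k' hk' α' β' hα' hβ' hβ'k
    have h := DFI_bilinear_coprime_of_C1_bound hK hM' hN' hα' (hCK M' N' hM' hN' k' hk' β' hβ' hβ'k)
    simpa only [hG, hS, max_eq_left hM', max_eq_left hN'] using h
  intro M N hN hNM k hk α β hα hβ
  have hM : 1 / 2 ≤ M := hN.trans hNM
  have hM0 : 0 < M := by linarith
  have hN0 : 0 < N := by linarith
  have h := DFI_bilinear_bound_of_coprime_case G hG0 hGmono hcore M N hM hN k hk α β hα hβ
  simp only [hG, hS, max_eq_left hM, max_eq_left hN] at h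
  have hSle := DFI_S_le_of_le hN0 hNM
  set nα := Real.sqrt (∑ m ∈ Icc 1 ⌊2 * M⌋₊, ‖α m‖ ^ 2) with hnα
  set nβ := Real.sqrt (∑ n ∈ Icc 1 ⌊2 * N⌋₊, ‖β n‖ ^ 2) with hnβ
  set τk : ℝ := Real.sqrt (k.natAbs.divisors.card : ℝ) with hτk
  have hε2 : (2 * ε / 2 : ℝ) = ε := by ring
  rw [hε2] at h
  calc _ ≤ _ := h
    _ = τk * nα * nβ * (Real.sqrt K * (1 + |(k : ℝ)|) ^ ε * (M * N) ^ ε *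
          (1 + |(k : ℝ)| / (M * N)) ^ (1 / 4 : ℝ)) *
        (M ^ (1 / 2 : ℝ) * N ^ (3 / 8 : ℝ) + N ^ (7 / 8 : ℝ) + M ^ (3 / 5 : ℝ) * N ^ (7 / 20 : ℝ) +
          M ^ (3 / 10 : ℝ) * N ^ (13 / 20 : ℝ)) := by ring
    _ ≤ τk * nα * nβ * (Real.sqrt K * (1 + |(k : ℝ)|) ^ ε * (M * N) ^ ε *
          (1 + |(k : ℝ)| / (M * N)) ^ (1 / 4 : ℝ)) *
        (2 * (M ^ (1 / 2 : ℝ) * N ^ (3 / 8 : ℝ) + M ^ (3 / 5 : ℝ) * N ^ (7 / 20 : ℝ))) := by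
        gcongr
    _ = _ := by ring

/-- **The named fact from Bettin–Chandee (6.4)** (case `A = 1`, untwisted second moment, all
`M, N ≥ 1/2`, coefficients `β` supported on integers coprime to `k`): the hypothesis of
`DFI_BC71tau_of_C1_bound` implies `DukeFriedlanderIwaniec1997_bilinearKloostermanFractions`.
So the input still to be supplied along Bettin–Chandee is exactly their §§3–6 bound (6.4) for
`𝓒₁ = ∑_{M < m ≤ 2M}|∑_{n ≤ 2N,(m,n)=1} β_n e(k m̄/n)|²` (`m` in `(⌊M⌋, ⌊2M⌋]`), for which
`KloostermanFractionsSquarefull.lean` (`𝓒₁ ≤ Z ∑_b b^{1/2} kfC …`, §6) and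
`KloostermanFractionsWeilBound.lean` (Theorem 5 of DFI, used in §6) are already in the tree.
[cite: BettinChandee2018, §§6–7] [cite: DukeFriedlanderIwaniec1997, Theorem 2] -/
theorem DukeFriedlanderIwaniec1997_bilinearKloostermanFractions_of_C1_bound
    (hC : ∀ ε : ℝ, 0 < ε → ∃ K : ℝ, 0 < K ∧
      ∀ (M N : ℝ), 1 / 2 ≤ M → 1 / 2 ≤ N → ∀ (k : ℤ), k ≠ 0 → ∀ (β : ℕ → ℂ),
        (∀ n : ℕ, β n ≠ 0 → N < n ∧ (n : ℝ) ≤ 2 * N) →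
        (∀ n : ℕ, β n ≠ 0 → n.Coprime k.natAbs) →
        ∑ m ∈ Ioc ⌊M⌋₊ ⌊2 * M⌋₊, ‖∑ n ∈ Icc 1 ⌊2 * N⌋₊,
            (if m.Coprime n then
              β n * Complex.exp (2 * Real.pi * Complex.I *
                ((k : ℂ) * ((((m : ZMod n)⁻¹).val : ℕ) : ℂ) / (n : ℂ)))
            else 0)‖ ^ 2 ≤
          K * (1 + |(k : ℝ)|) ^ ε * (∑ n ∈ Icc 1 ⌊2 * N⌋₊, ‖β n‖ ^ 2) * (M * N) ^ ε *
            (1 + |(k : ℝ)| / (M * N)) ^ (1 / 2 : ℝ) *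
            (M * N ^ (3 / 4 : ℝ) + N ^ (7 / 4 : ℝ) + M ^ (6 / 5 : ℝ) * N ^ (7 / 10 : ℝ) +
              M ^ (3 / 5 : ℝ) * N ^ (13 / 10 : ℝ))) :
    DukeFriedlanderIwaniec1997_bilinearKloostermanFractions :=
  DukeFriedlanderIwaniec1997_bilinearKloostermanFractions_of_BC71tau_MgeN
    (DFI_BC71tau_of_C1_bound hC)

end Literature.NumberTheory.LFunctions

end
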